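import Summits.Ventures.Crystal3D.Theorems.StickyWulffConstantGenericWallFloorBarlowCoreAvoid
import Summits.Ventures.Crystal3D.Theorems.StickyWulffConstantGenericWallFloorBarlowRowTopFamily
import HarnessLib

/-!
# The two «++» c-layer ROW families under `FramesApart` (option (C)): `rowBottomFamily_spec_apart`, `rowTopFamily_spec_apart`
# (crux `GenericWallFloor`, stmt-Ventures-19480, line `WallLedgerG`; lane T's row corner at OffR := `FramesApart`, cf-p1 (xxxvii⁵))

HONEST FRAMING. Venture `Summits/Ventures/Crystal3D` (cell `crystal3d-full`), helper `--supports` the crux `GenericWallFloor`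
(stmt-Ventures-19480) of `route-Ventures-StickyWulffConstant`, registered line `WallLedgerG`, open stub `stub_twoSlabAdhesion`.
Rung credit only; F-C1 not moved; NOT the stub.  Inputs BY NAME: E1 (`hsE`, `hcert`).

`rowBottomFamily_spec` / `rowTopFamily_spec` (`…BarlowRowBottomFamily`, `…BarlowRowTopFamily`) deliver the inputs of the two-family count
for the ROW families (one walker per «++» c-layer row crossing the window, frame `Lᵢ`, slot `r`, row frame set
`insert (twinFrame Lᵢ (Lᵢ e₃)) (chainFrames z Lᵢ r)`) under the POSITIONAL `hoff`.  Here they are re-assembled with `hoff` replaced by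
`hapart : ∀ F ∈ insert (twinFrame Lᵢ (Lᵢ e₃)) (chainFrames z Lᵢ r), F·Λ₀ ≠ L′·Λ₀ ∧ F·Λ₀ ≠ (twinFrame L′ (L′ e₃))·Λ₀` (clauses (i)/(ii) of
`FramesApart` for a row plate, `corner_of_not_zigGood`): validity (`rowStart_valid`), injectivity (`rowFamily_walkRun_injOn`) and the
own-side sealing argument (`twelve_le_card_contacts_of_complete_site`) are untouched; the far side now comes from
`walkEnd_not_high_apart` / `walkEnd_not_low_apart` (`…BarlowCoreAvoid`).  Hypotheses verbatim otherwise (the lateral budget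
`hρin` already has the extra unit of rim); conclusions without the reach-set clause.
* **`rowBottomFamily_spec_apart`** (vertical `e₃`, plate 1) and **`rowTopFamily_spec_apart`** (vertical `−e₃`, plate 2).
WHAT THIS IS NOT: not the count, not the lines; F-C1 not moved.
-/

noncomputable section

namespace Summit.Ventures.Crystal3D.Theorems

open Finset
open Literature.MathematicalPhysics.StatisticalMechanics
open Summit.Ventures.Crystal3D.Cruxes.TextureLiminf.TexShadow (stacking)
open scoped InnerProductSpace

variable {X : Finset (EuclideanSpace ℝ (Fin 3))}

section Cell

variable (σ₁ : ℤ → ℤ) (L₁ : EuclideanSpace ℝ (Fin 3) ≃ₗᵢ[ℝ] EuclideanSpace ℝ (Fin 3)) (s₀ : EuclideanSpace ℝ (Fin 3))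

open scoped Classical in
/-- **The bottom ROW family, frames apart from the top plate, delivers every input of the frame-separated two-family count.**
Verbatim `rowBottomFamily_spec` with `hoff` replaced by `hapart` (no row frame carries `L₂·Λ₀` or its basal twin) and without the
reach-set conclusion. -/
theorem rowBottomFamily_spec_apart (hσ₁ : IsHaggSeq σ₁) (hX : ∀ p ∈ X, ∀ q ∈ X, p ≠ q → 1 ≤ dist p q)
    {sE : EuclideanSpace ℝ (Fin 3)} (hsE : sE ∈ fccSlots) (hcert : ExactOnly 0 (fccSlots.filter fun w => 0 < ⟪w, sE⟫_ℝ))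
    -- the cell
    {σ₂ : ℤ → ℤ} (hσ₂ : IsHaggSeq σ₂) (L₂ : EuclideanSpace ℝ (Fin 3) ≃ₗᵢ[ℝ] EuclideanSpace ℝ (Fin 3)) (s₂ : EuclideanSpace ℝ (Fin 3))
    (R₀ h ρ : ℝ) (hR₀ : 6 ≤ R₀) (hh : 0 ≤ h) (hρ : 1 ≤ ρ) (P₁ P₂ : Finset (EuclideanSpace ℝ (Fin 3))) (hP₁X : P₁ ⊆ X) (hP₂X : P₂ ⊆ X)
    (hcell : ∀ p ∈ X, -(2 * R₀) ≤ p 2 ∧ p 2 ≤ h + 2 * R₀ ∧ p 0 ^ 2 + p 1 ^ 2 ≤ ρ ^ 2)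
    (hP₁ : ∀ p, p ∈ P₁ ↔ (p ∈ stacking L₁ s₀ σ₁ ∧ -(2 * R₀) ≤ p 2 ∧ p 2 ≤ -R₀ ∧ p 0 ^ 2 + p 1 ^ 2 ≤ ρ ^ 2))
    (hP₂ : ∀ p, p ∈ P₂ ↔ (p ∈ stacking L₂ s₂ σ₂ ∧ h + R₀ ≤ p 2 ∧ p 2 ≤ h + 2 * R₀ ∧ p 0 ^ 2 + p 1 ^ 2 ≤ ρ ^ 2))
    -- the row data
    {r : EuclideanSpace ℝ (Fin 3)} (hr : r ∈ fccSlots) (α β : ℤ)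
    (hrαβ : r = (α : ℝ) • triangularVec₁ 1 + (β : ℝ) • triangularVec₂ 1)
    (hsteep : Real.sqrt 2 / 2 ≤ ⟪L₁ r, EuclideanSpace.single (2 : Fin 3) (1 : ℝ)⟫_ℝ)
    -- frames apart from the top plate
    (hapart : ∀ F ∈ insert (twinFrame L₁ (L₁ (EuclideanSpace.single (2 : Fin 3) (1 : ℝ))))
        (chainFrames (EuclideanSpace.single (2 : Fin 3) (1 : ℝ)) L₁ r),
      F '' fccStacking 1 (Real.sqrt (2 / 3)) ≠ L₂ '' fccStacking 1 (Real.sqrt (2 / 3)) ∧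
      F '' fccStacking 1 (Real.sqrt (2 / 3)) ≠
        (twinFrame L₂ (L₂ (EuclideanSpace.single (2 : Fin 3) (1 : ℝ)))) '' fccStacking 1 (Real.sqrt (2 / 3)))
    -- the family
    (H ρin : ℝ) (hHlo : -(2 * R₀) + 2 ≤ H) (hHhi : H ≤ -R₀ - 3)
    (hρin : ρin + 8 / 3 * (h + 4 * R₀) + 2 ≤ ρ - 1)
    {ι : Type*} (T : Finset ι) (mi ai bi : ι → ℤ)
    (hcc : ∀ i ∈ T, σ₁ (mi i) = 1 ∧ σ₁ (mi i - 1) = 1)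
    (hlow : ∀ i ∈ T, H ≤ ⟪L₁ (barlowPos 1 (Real.sqrt (2 / 3)) σ₁ (mi i) (ai i) (bi i)) + s₀, EuclideanSpace.single (2 : Fin 3) (1 : ℝ)⟫_ℝ)
    (hpred : ∀ i ∈ T, ⟪L₁ (barlowPos 1 (Real.sqrt (2 / 3)) σ₁ (mi i) (ai i - α) (bi i - β)) + s₀,
      EuclideanSpace.single (2 : Fin 3) (1 : ℝ)⟫_ℝ < H)
    (hinjT : ∀ i ∈ T, ∀ j ∈ T,
      barlowPos 1 (Real.sqrt (2 / 3)) σ₁ (mi i) (ai i) (bi i) = barlowPos 1 (Real.sqrt (2 / 3)) σ₁ (mi j) (ai j) (bi j) → i = j)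
    (hlat : ∀ i ∈ T, Real.sqrt ((L₁ (barlowPos 1 (Real.sqrt (2 / 3)) σ₁ (mi i) (ai i) (bi i)) + s₀) 0 ^ 2 +
      (L₁ (barlowPos 1 (Real.sqrt (2 / 3)) σ₁ (mi i) (ai i) (bi i)) + s₀) 1 ^ 2) ≤ ρin)
    -- fuel
    {N : ℕ} (hN2 : 8 * (h + 4 * R₀) < 3 * (N : ℝ)) :
    (∀ i ∈ T,
      WalkInv X (EuclideanSpace.single (2 : Fin 3) (1 : ℝ))
          (L₁ (barlowPos 1 (Real.sqrt (2 / 3)) σ₁ (mi i) (ai i) (bi i)) + s₀, [⟨L₁, r, 0⟩]) ∧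
      StackWF (EuclideanSpace.single (2 : Fin 3) (1 : ℝ)) ([⟨L₁, r, 0⟩] : List WalkEntry) ∧
      ([⟨L₁, r, 0⟩] : List WalkEntry).getLast? = some ⟨L₁, r, 0⟩ ∧
      (∃ e rest, ([⟨L₁, r, 0⟩] : List WalkEntry) = e :: rest ∧
        WalkCertified12 X (L₁ (barlowPos 1 (Real.sqrt (2 / 3)) σ₁ (mi i) (ai i) (bi i)) + s₀) e) ∧
      8 * (h + 2 * R₀ - ⟪L₁ (barlowPos 1 (Real.sqrt (2 / 3)) σ₁ (mi i) (ai i) (bi i)) + s₀,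
        EuclideanSpace.single (2 : Fin 3) (1 : ℝ)⟫_ℝ) < 3 * N ∧
      (walkRun X (EuclideanSpace.single (2 : Fin 3) (1 : ℝ)) N
          (L₁ (barlowPos 1 (Real.sqrt (2 / 3)) σ₁ (mi i) (ai i) (bi i)) + s₀, [⟨L₁, r, 0⟩])).1 ∈
        X.filter (fun y => (X.filter fun q => dist y q = 1).card ≠ 12 ∧ -R₀ - 2 ≤ y 2 ∧ y 2 ≤ h + R₀ + 2)) ∧
    (∀ i ∈ T, ∀ j ∈ T,
      walkRun X (EuclideanSpace.single (2 : Fin 3) (1 : ℝ)) N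
          (L₁ (barlowPos 1 (Real.sqrt (2 / 3)) σ₁ (mi i) (ai i) (bi i)) + s₀, [⟨L₁, r, 0⟩]) =
        walkRun X (EuclideanSpace.single (2 : Fin 3) (1 : ℝ)) N
          (L₁ (barlowPos 1 (Real.sqrt (2 / 3)) σ₁ (mi j) (ai j) (bi j)) + s₀, [⟨L₁, r, 0⟩]) → i = j) := by
  set e₃ : EuclideanSpace ℝ (Fin 3) := EuclideanSpace.single (2 : Fin 3) (1 : ℝ) with he₃
  have he₃n : ‖e₃‖ = 1 := by rw [he₃, PiLp.norm_single, norm_one]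
  have he₃i : ∀ d : EuclideanSpace ℝ (Fin 3), ⟪d, e₃⟫_ℝ = d 2 := fun d => by
    rw [he₃, EuclideanSpace.inner_single_right]; simp
  set bp : ℤ → ℤ → ℤ → EuclideanSpace ℝ (Fin 3) := fun m a b => barlowPos 1 (Real.sqrt (2 / 3)) σ₁ m a b with hbp
  have hLr : ‖L₁ r‖ = 1 := by rw [LinearIsometryEquiv.norm_map, norm_eq_one_of_mem_fccSlots hr]
  have hLr2 : (L₁ r) 2 ≤ 1 := by
    have h1 := abs_apply_sub_le_dist (L₁ r) 0 2
    rw [dist_zero_right, hLr] at h1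
    have : (0 : EuclideanSpace ℝ (Fin 3)) 2 = 0 := rfl
    rw [this, sub_zero] at h1
    exact (abs_le.1 h1).2
  -- the predecessor of each start: `q i + r = p i`
  have hqp : ∀ i, bp (mi i) (ai i - α) (bi i - β) + r = bp (mi i) (ai i) (bi i) := by
    intro i
    show barlowPos 1 (Real.sqrt (2 / 3)) σ₁ (mi i) (ai i - α) (bi i - β) + r = barlowPos 1 (Real.sqrt (2 / 3)) σ₁ (mi i) (ai i) (bi i)
    rw [hrαβ, barlowPos_add_inplane, sub_add_cancel, sub_add_cancel]
  have hqeq : ∀ i, bp (mi i) (ai i) (bi i) - r = bp (mi i) (ai i - α) (bi i - β) := fun i => by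
    rw [← hqp i, add_sub_cancel_right]
  -- heights and lateral radius of the predecessor
  have hq2 : ∀ i, (L₁ (bp (mi i) (ai i - α) (bi i - β)) + s₀) 2 = (L₁ (bp (mi i) (ai i) (bi i)) + s₀) 2 - (L₁ r) 2 := by
    intro i; rw [← hqp i, map_add]; simp; ring
  -- the predecessor is deep, hence full
  have hfullpred : ∀ i ∈ T, L₁ (bp (mi i) (ai i - α) (bi i - β)) + s₀ ∈ X ∧
      ∀ w ∈ fccSlots, L₁ (bp (mi i) (ai i - α) (bi i - β)) + s₀ + L₁ w ∈ X := by
    intro i hi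
    have hph : (L₁ (bp (mi i) (ai i - α) (bi i - β)) + s₀) 2 < H := by rw [← he₃i]; exact hpred i hi
    have hpl : H - 1 ≤ (L₁ (bp (mi i) (ai i - α) (bi i - β)) + s₀) 2 := by
      rw [hq2 i]; have := hlow i hi; rw [he₃i] at this; linarith
    have hplat : Real.sqrt ((L₁ (bp (mi i) (ai i - α) (bi i - β)) + s₀) 0 ^ 2 +
        (L₁ (bp (mi i) (ai i - α) (bi i - β)) + s₀) 1 ^ 2) ≤ ρin + 1 := by
      have h1 := sqrt_lateral_add_le (L₁ (bp (mi i) (ai i) (bi i)) + s₀) (-(L₁ r))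
      have e : L₁ (bp (mi i) (ai i) (bi i)) + s₀ + -L₁ r = L₁ (bp (mi i) (ai i - α) (bi i - β)) + s₀ := by
        rw [← hqp i, map_add]; abel
      rw [e, norm_neg, hLr] at h1
      have := hlat i hi; linarith
    refine barlow_cc_full σ₁ L₁ s₀ (mi i) (ai i - α) (bi i - β) (hcc i hi).1 (hcc i hi).2
      (barlowWindow_complete L₁ s₀ R₀ ρ hρ P₁ hP₁X hP₁ (mi i) (ai i - α) (bi i - β) (by linarith) (by linarith) ?_)
    have h0 : 0 ≤ (L₁ (bp (mi i) (ai i - α) (bi i - β)) + s₀) 0 ^ 2 + (L₁ (bp (mi i) (ai i - α) (bi i - β)) + s₀) 1 ^ 2 := by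
      positivity
    have hrr : Real.sqrt ((L₁ (bp (mi i) (ai i - α) (bi i - β)) + s₀) 0 ^ 2 +
        (L₁ (bp (mi i) (ai i - α) (bi i - β)) + s₀) 1 ^ 2) ≤ ρ - 1 := by
      have : 0 ≤ 8 / 3 * (h + 4 * R₀) := by positivity
      linarith
    have h7 := pow_le_pow_left₀ (Real.sqrt_nonneg _) hrr 2
    rwa [Real.sq_sqrt h0] at h7
  -- validity of every start
  have hvalid : ∀ i ∈ T, WalkInv X e₃ (L₁ (bp (mi i) (ai i) (bi i)) + s₀, [⟨L₁, r, 0⟩]) ∧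
      StackWF e₃ ([⟨L₁, r, 0⟩] : List WalkEntry) ∧ ([⟨L₁, r, 0⟩] : List WalkEntry).getLast? = some ⟨L₁, r, 0⟩ ∧
      WalkCertified12 X (L₁ (bp (mi i) (ai i) (bi i)) + s₀) ⟨L₁, r, 0⟩ := fun i hi =>
    rowStart_valid L₁ s₀ hr hsteep (hqp i) (hfullpred i hi).1 (hfullpred i hi).2
  -- injectivity
  have hinj := rowFamily_walkRun_injOn hX hsE hcert he₃n L₁ s₀ hr hsteep T (fun i => bp (mi i) (ai i) (bi i))
    (fun i hi => by simp only [hqeq i]; exact hfullpred i hi) H hlow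
    (fun i hi => by simp only [hqeq i]; exact hpred i hi) hinjT N
  refine ⟨fun i hi => ?_, hinj⟩
  obtain ⟨hI, hW, hlast, hC⟩ := hvalid i hi
  have hstartX : L₁ (bp (mi i) (ai i) (bi i)) + s₀ ∈ X := hI.1
  have hstart2 : H ≤ (L₁ (bp (mi i) (ai i) (bi i)) + s₀) 2 := by rw [← he₃i]; exact hlow i hi
  have hfuel : 8 * (h + 2 * R₀ - ⟪L₁ (bp (mi i) (ai i) (bi i)) + s₀, e₃⟫_ℝ) < 3 * N := by
    rw [he₃i]; linarith
  -- frames of the family, lateral margin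
  have hM₁ : ∀ stk : List WalkEntry, StackSound e₃ stk → StackWF e₃ stk → stk.getLast? = some ⟨L₁, r, 0⟩ →
      ∀ e ∈ stk, e.frame ∈ insert (twinFrame L₁ (L₁ e₃)) (chainFrames e₃ L₁ r) := mem_rowFrames_of_stack
  have hlat' : Real.sqrt ((L₁ (bp (mi i) (ai i) (bi i)) + s₀) 0 ^ 2 + (L₁ (bp (mi i) (ai i) (bi i)) + s₀) 1 ^ 2) +
      8 / 3 * (h + 4 * R₀) ≤ ρ - 2 := by have := hlat i hi; linarith
  have hρ2 : 2 ≤ ρ := by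
    have h1 := hlat i hi
    have h2 := Real.sqrt_nonneg ((L₁ (bp (mi i) (ai i) (bi i)) + s₀) 0 ^ 2 + (L₁ (bp (mi i) (ai i) (bi i)) + s₀) 1 ^ 2)
    have h3 : 0 ≤ 8 / 3 * (h + 4 * R₀) := by positivity
    linarith
  -- the end: not high (core avoidance: no frame of the family carries the top plate's lattice or twin), lateral radius, `≤ 11` contacts
  obtain ⟨hyX, hydeg, hylat, -⟩ := walkEnd_not_high_apart hX hsE hcert hσ₂ L₂ s₂ R₀ h ρ hρ2 P₂ hP₂X hcell hP₂
    (insert (twinFrame L₁ (L₁ e₃)) (chainFrames e₃ L₁ r)) hM₁ hapart (s := (L₁ (bp (mi i) (ai i) (bi i)) + s₀, [⟨L₁, r, 0⟩]))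
    hI hW hlast hlat' hfuel
  have hylat1 : (walkRun X e₃ N (L₁ (bp (mi i) (ai i) (bi i)) + s₀, [⟨L₁, r, 0⟩])).1 0 ^ 2 +
      (walkRun X e₃ N (L₁ (bp (mi i) (ai i) (bi i)) + s₀, [⟨L₁, r, 0⟩])).1 1 ^ 2 ≤ (ρ - 1) ^ 2 := hylat.trans (by nlinarith)
  -- NOT LOW by sealing: below `−R₀ − 2` the end would be a plate site with twelve neighbours
  have hmono := walkRun_height_ge hX hsE hcert he₃n N (L₁ (bp (mi i) (ai i) (bi i)) + s₀, [⟨L₁, r, 0⟩]) hI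
  simp only at hmono
  rw [he₃i, he₃i] at hmono
  set y := (walkRun X e₃ N (L₁ (bp (mi i) (ai i) (bi i)) + s₀, [⟨L₁, r, 0⟩])).1 with hy
  have hlow' : -R₀ - 2 ≤ y 2 := by
    by_contra hlt
    push Not at hlt
    -- `y` is a plate ball
    have hyP : y ∈ P₁ := by
      by_contra hyP
      exact stacking_sealing_below hσ₁ L₁ s₀ (-(2 * R₀)) (-R₀) ρ hρ X P₁ hX hP₁X hP₁ y hyX hyP (hcell y hyX).1
        (by linarith) hylat1
    obtain ⟨⟨y', hy'S, hyy'⟩, -, -, -⟩ := (hP₁ y).1 hyP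
    obtain ⟨m, a, b, rfl⟩ := hy'S
    have hyy : L₁ (barlowPos 1 (Real.sqrt (2 / 3)) σ₁ m a b) + s₀ = y := hyy'
    -- all its touching sites are occupied
    have hcomp := barlowWindow_complete L₁ s₀ R₀ ρ hρ P₁ hP₁X hP₁ m a b (by rw [hyy]; linarith) (by rw [hyy]; linarith)
      (by rw [hyy]; exact hylat1)
    have h12 := twelve_le_card_contacts_of_complete_site hσ₁ L₁ s₀ m a b hcomp
    rw [hyy] at h12
    omega
  have hPAY : y ∈ X.filter (fun y => (X.filter fun q => dist y q = 1).card ≠ 12 ∧ -R₀ - 2 ≤ y 2 ∧ y 2 ≤ h + R₀ + 2) :=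
    walkEnd_mem_PAY_apart hX hsE hcert hσ₂ L₂ s₂ R₀ h ρ hρ2 P₂ hP₂X hcell hP₂ (insert (twinFrame L₁ (L₁ e₃)) (chainFrames e₃ L₁ r))
      hM₁ hapart hI hW hlast hlat' hfuel hlow'
  exact ⟨hI, hW, hlast, ⟨⟨L₁, r, 0⟩, [], rfl, hC⟩, hfuel, hPAY⟩

end Cell

section CellTop

variable (σ₂ : ℤ → ℤ) (L₂ : EuclideanSpace ℝ (Fin 3) ≃ₗᵢ[ℝ] EuclideanSpace ℝ (Fin 3)) (s₂ : EuclideanSpace ℝ (Fin 3))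

open scoped Classical in
/-- **The top ROW family, frames apart from the bottom plate, delivers every input of the frame-separated two-family count**
(vertical `−e₃`).  Verbatim `rowTopFamily_spec` with `hoff` replaced by `hapart` and without the reach-set conclusion. -/
theorem rowTopFamily_spec_apart (hσ₂ : IsHaggSeq σ₂) (hX : ∀ p ∈ X, ∀ q ∈ X, p ≠ q → 1 ≤ dist p q)
    {sE : EuclideanSpace ℝ (Fin 3)} (hsE : sE ∈ fccSlots) (hcert : ExactOnly 0 (fccSlots.filter fun w => 0 < ⟪w, sE⟫_ℝ))
    -- the cell
    {σ₁ : ℤ → ℤ} (hσ₁ : IsHaggSeq σ₁) (L₁ : EuclideanSpace ℝ (Fin 3) ≃ₗᵢ[ℝ] EuclideanSpace ℝ (Fin 3)) (s₀ : EuclideanSpace ℝ (Fin 3))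
    (R₀ h ρ : ℝ) (hR₀ : 6 ≤ R₀) (hh : 0 ≤ h) (hρ : 1 ≤ ρ) (P₁ P₂ : Finset (EuclideanSpace ℝ (Fin 3))) (hP₁X : P₁ ⊆ X) (hP₂X : P₂ ⊆ X)
    (hcell : ∀ p ∈ X, -(2 * R₀) ≤ p 2 ∧ p 2 ≤ h + 2 * R₀ ∧ p 0 ^ 2 + p 1 ^ 2 ≤ ρ ^ 2)
    (hP₁ : ∀ p, p ∈ P₁ ↔ (p ∈ stacking L₁ s₀ σ₁ ∧ -(2 * R₀) ≤ p 2 ∧ p 2 ≤ -R₀ ∧ p 0 ^ 2 + p 1 ^ 2 ≤ ρ ^ 2))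
    (hP₂ : ∀ p, p ∈ P₂ ↔ (p ∈ stacking L₂ s₂ σ₂ ∧ h + R₀ ≤ p 2 ∧ p 2 ≤ h + 2 * R₀ ∧ p 0 ^ 2 + p 1 ^ 2 ≤ ρ ^ 2))
    -- the row data
    {r : EuclideanSpace ℝ (Fin 3)} (hr : r ∈ fccSlots) (α β : ℤ)
    (hrαβ : r = (α : ℝ) • triangularVec₁ 1 + (β : ℝ) • triangularVec₂ 1)
    (hsteep : Real.sqrt 2 / 2 ≤ ⟪L₂ r, -EuclideanSpace.single (2 : Fin 3) (1 : ℝ)⟫_ℝ)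
    -- frames apart from the bottom plate
    (hapart : ∀ F ∈ insert (twinFrame L₂ (L₂ (EuclideanSpace.single (2 : Fin 3) (1 : ℝ))))
        (chainFrames (-EuclideanSpace.single (2 : Fin 3) (1 : ℝ)) L₂ r),
      F '' fccStacking 1 (Real.sqrt (2 / 3)) ≠ L₁ '' fccStacking 1 (Real.sqrt (2 / 3)) ∧
      F '' fccStacking 1 (Real.sqrt (2 / 3)) ≠
        (twinFrame L₁ (L₁ (EuclideanSpace.single (2 : Fin 3) (1 : ℝ)))) '' fccStacking 1 (Real.sqrt (2 / 3)))
    -- the family (heights along −e₃)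
    (H ρin : ℝ) (hHlo : -(h + 2 * R₀) + 2 ≤ H) (hHhi : H ≤ -(h + R₀) - 3)
    (hρin : ρin + 8 / 3 * (h + 4 * R₀) + 2 ≤ ρ - 1)
    {ι : Type*} (T : Finset ι) (mi ai bi : ι → ℤ)
    (hcc : ∀ i ∈ T, σ₂ (mi i) = 1 ∧ σ₂ (mi i - 1) = 1)
    (hlow : ∀ i ∈ T, H ≤ ⟪L₂ (barlowPos 1 (Real.sqrt (2 / 3)) σ₂ (mi i) (ai i) (bi i)) + s₂, -EuclideanSpace.single (2 : Fin 3) (1 : ℝ)⟫_ℝ)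
    (hpred : ∀ i ∈ T, ⟪L₂ (barlowPos 1 (Real.sqrt (2 / 3)) σ₂ (mi i) (ai i - α) (bi i - β)) + s₂,
      -EuclideanSpace.single (2 : Fin 3) (1 : ℝ)⟫_ℝ < H)
    (hinjT : ∀ i ∈ T, ∀ j ∈ T,
      barlowPos 1 (Real.sqrt (2 / 3)) σ₂ (mi i) (ai i) (bi i) = barlowPos 1 (Real.sqrt (2 / 3)) σ₂ (mi j) (ai j) (bi j) → i = j)
    (hlat : ∀ i ∈ T, Real.sqrt ((L₂ (barlowPos 1 (Real.sqrt (2 / 3)) σ₂ (mi i) (ai i) (bi i)) + s₂) 0 ^ 2 +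
      (L₂ (barlowPos 1 (Real.sqrt (2 / 3)) σ₂ (mi i) (ai i) (bi i)) + s₂) 1 ^ 2) ≤ ρin)
    -- fuel
    {N : ℕ} (hN2 : 8 * (h + 4 * R₀) < 3 * (N : ℝ)) :
    (∀ i ∈ T,
      WalkInv X (-EuclideanSpace.single (2 : Fin 3) (1 : ℝ))
          (L₂ (barlowPos 1 (Real.sqrt (2 / 3)) σ₂ (mi i) (ai i) (bi i)) + s₂, [⟨L₂, r, 0⟩]) ∧
      StackWF (-EuclideanSpace.single (2 : Fin 3) (1 : ℝ)) ([⟨L₂, r, 0⟩] : List WalkEntry) ∧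
      ([⟨L₂, r, 0⟩] : List WalkEntry).getLast? = some ⟨L₂, r, 0⟩ ∧
      (∃ e rest, ([⟨L₂, r, 0⟩] : List WalkEntry) = e :: rest ∧
        WalkCertified12 X (L₂ (barlowPos 1 (Real.sqrt (2 / 3)) σ₂ (mi i) (ai i) (bi i)) + s₂) e) ∧
      8 * (2 * R₀ - ⟪L₂ (barlowPos 1 (Real.sqrt (2 / 3)) σ₂ (mi i) (ai i) (bi i)) + s₂,
        -EuclideanSpace.single (2 : Fin 3) (1 : ℝ)⟫_ℝ) < 3 * N ∧
      (walkRun X (-EuclideanSpace.single (2 : Fin 3) (1 : ℝ)) N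
          (L₂ (barlowPos 1 (Real.sqrt (2 / 3)) σ₂ (mi i) (ai i) (bi i)) + s₂, [⟨L₂, r, 0⟩])).1 ∈
        X.filter (fun y => (X.filter fun q => dist y q = 1).card ≠ 12 ∧ -R₀ - 2 ≤ y 2 ∧ y 2 ≤ h + R₀ + 2)) ∧
    (∀ i ∈ T, ∀ j ∈ T,
      walkRun X (-EuclideanSpace.single (2 : Fin 3) (1 : ℝ)) N
          (L₂ (barlowPos 1 (Real.sqrt (2 / 3)) σ₂ (mi i) (ai i) (bi i)) + s₂, [⟨L₂, r, 0⟩]) =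
        walkRun X (-EuclideanSpace.single (2 : Fin 3) (1 : ℝ)) N
          (L₂ (barlowPos 1 (Real.sqrt (2 / 3)) σ₂ (mi j) (ai j) (bi j)) + s₂, [⟨L₂, r, 0⟩]) → i = j) := by
  set zt : EuclideanSpace ℝ (Fin 3) := -EuclideanSpace.single (2 : Fin 3) (1 : ℝ) with hzt
  have hztn : ‖zt‖ = 1 := by rw [hzt, norm_neg, PiLp.norm_single, norm_one]
  have hzti : ∀ d : EuclideanSpace ℝ (Fin 3), ⟪d, zt⟫_ℝ = -d 2 := fun d => by
    rw [hzt, inner_neg_right, EuclideanSpace.inner_single_right]; simp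
  set bp : ℤ → ℤ → ℤ → EuclideanSpace ℝ (Fin 3) := fun m a b => barlowPos 1 (Real.sqrt (2 / 3)) σ₂ m a b with hbp
  have hLr : ‖L₂ r‖ = 1 := by rw [LinearIsometryEquiv.norm_map, norm_eq_one_of_mem_fccSlots hr]
  have hLr2 : -1 ≤ (L₂ r) 2 := by
    have h1 := abs_apply_sub_le_dist (L₂ r) 0 2
    rw [dist_zero_right, hLr] at h1
    have : (0 : EuclideanSpace ℝ (Fin 3)) 2 = 0 := rfl
    rw [this, sub_zero] at h1
    exact (abs_le.1 h1).1
  -- the predecessor of each start: `q i + r = p i`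
  have hqp : ∀ i, bp (mi i) (ai i - α) (bi i - β) + r = bp (mi i) (ai i) (bi i) := by
    intro i
    show barlowPos 1 (Real.sqrt (2 / 3)) σ₂ (mi i) (ai i - α) (bi i - β) + r = barlowPos 1 (Real.sqrt (2 / 3)) σ₂ (mi i) (ai i) (bi i)
    rw [hrαβ, barlowPos_add_inplane, sub_add_cancel, sub_add_cancel]
  have hqeq : ∀ i, bp (mi i) (ai i) (bi i) - r = bp (mi i) (ai i - α) (bi i - β) := fun i => by
    rw [← hqp i, add_sub_cancel_right]
  have hq2 : ∀ i, (L₂ (bp (mi i) (ai i - α) (bi i - β)) + s₂) 2 = (L₂ (bp (mi i) (ai i) (bi i)) + s₂) 2 - (L₂ r) 2 := by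
    intro i; rw [← hqp i, map_add]; simp; ring
  -- the predecessor is deep, hence full
  have hfullpred : ∀ i ∈ T, L₂ (bp (mi i) (ai i - α) (bi i - β)) + s₂ ∈ X ∧
      ∀ w ∈ fccSlots, L₂ (bp (mi i) (ai i - α) (bi i - β)) + s₂ + L₂ w ∈ X := by
    intro i hi
    have hpredi := hpred i hi
    rw [hzti, hq2 i] at hpredi
    have hlowi := hlow i hi
    rw [hzti] at hlowi
    -- true heights: the predecessor lies in `[−H, −H + 1]`-ish: `h + R₀ + 1 ≤ · ≤ h + 2R₀ − 1`
    have hpl : h + R₀ + 1 ≤ (L₂ (bp (mi i) (ai i - α) (bi i - β)) + s₂) 2 := by rw [hq2 i]; linarith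
    have hphh : (L₂ (bp (mi i) (ai i - α) (bi i - β)) + s₂) 2 ≤ h + 2 * R₀ - 1 := by rw [hq2 i]; linarith
    have hplat : Real.sqrt ((L₂ (bp (mi i) (ai i - α) (bi i - β)) + s₂) 0 ^ 2 +
        (L₂ (bp (mi i) (ai i - α) (bi i - β)) + s₂) 1 ^ 2) ≤ ρin + 1 := by
      have h1 := sqrt_lateral_add_le (L₂ (bp (mi i) (ai i) (bi i)) + s₂) (-(L₂ r))
      have e : L₂ (bp (mi i) (ai i) (bi i)) + s₂ + -L₂ r = L₂ (bp (mi i) (ai i - α) (bi i - β)) + s₂ := by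
        rw [← hqp i, map_add]; abel
      rw [e, norm_neg, hLr] at h1
      have := hlat i hi; linarith
    refine barlow_cc_full σ₂ L₂ s₂ (mi i) (ai i - α) (bi i - β) (hcc i hi).1 (hcc i hi).2
      (barlowWindow_complete_gen L₂ s₂ (h + R₀) (h + 2 * R₀) ρ hρ P₂ hP₂X hP₂ (mi i) (ai i - α) (bi i - β)
        (by linarith) (by linarith) ?_)
    have h0 : 0 ≤ (L₂ (bp (mi i) (ai i - α) (bi i - β)) + s₂) 0 ^ 2 + (L₂ (bp (mi i) (ai i - α) (bi i - β)) + s₂) 1 ^ 2 := by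
      positivity
    have hrr : Real.sqrt ((L₂ (bp (mi i) (ai i - α) (bi i - β)) + s₂) 0 ^ 2 +
        (L₂ (bp (mi i) (ai i - α) (bi i - β)) + s₂) 1 ^ 2) ≤ ρ - 1 := by
      have : 0 ≤ 8 / 3 * (h + 4 * R₀) := by positivity
      linarith
    have h7 := pow_le_pow_left₀ (Real.sqrt_nonneg _) hrr 2
    rwa [Real.sq_sqrt h0] at h7
  -- validity of every start
  have hvalid : ∀ i ∈ T, WalkInv X zt (L₂ (bp (mi i) (ai i) (bi i)) + s₂, [⟨L₂, r, 0⟩]) ∧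
      StackWF zt ([⟨L₂, r, 0⟩] : List WalkEntry) ∧ ([⟨L₂, r, 0⟩] : List WalkEntry).getLast? = some ⟨L₂, r, 0⟩ ∧
      WalkCertified12 X (L₂ (bp (mi i) (ai i) (bi i)) + s₂) ⟨L₂, r, 0⟩ := fun i hi =>
    rowStart_valid L₂ s₂ hr hsteep (hqp i) (hfullpred i hi).1 (hfullpred i hi).2
  -- injectivity
  have hinj := rowFamily_walkRun_injOn hX hsE hcert hztn L₂ s₂ hr hsteep T (fun i => bp (mi i) (ai i) (bi i))
    (fun i hi => by simp only [hqeq i]; exact hfullpred i hi) H hlow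
    (fun i hi => by simp only [hqeq i]; exact hpred i hi) hinjT N
  refine ⟨fun i hi => ?_, hinj⟩
  obtain ⟨hI, hW, hlast, hC⟩ := hvalid i hi
  have hstartX : L₂ (bp (mi i) (ai i) (bi i)) + s₂ ∈ X := hI.1
  have hlowi := hlow i hi
  rw [hzti] at hlowi
  have hfuel : 8 * (2 * R₀ - ⟪L₂ (bp (mi i) (ai i) (bi i)) + s₂, zt⟫_ℝ) < 3 * N := by
    rw [hzti]; linarith
  -- frames of the family, lateral margin
  have hM₂ : ∀ stk : List WalkEntry, StackSound zt stk → StackWF zt stk → stk.getLast? = some ⟨L₂, r, 0⟩ →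
      ∀ e ∈ stk, e.frame ∈ insert (twinFrame L₂ (L₂ (EuclideanSpace.single (2 : Fin 3) (1 : ℝ)))) (chainFrames zt L₂ r) :=
    mem_rowFrames_of_stack
  have hlat' : Real.sqrt ((L₂ (bp (mi i) (ai i) (bi i)) + s₂) 0 ^ 2 + (L₂ (bp (mi i) (ai i) (bi i)) + s₂) 1 ^ 2) +
      8 / 3 * (h + 4 * R₀) ≤ ρ - 2 := by have := hlat i hi; linarith
  have hρ2 : 2 ≤ ρ := by
    have h1 := hlat i hi
    have h2 := Real.sqrt_nonneg ((L₂ (bp (mi i) (ai i) (bi i)) + s₂) 0 ^ 2 + (L₂ (bp (mi i) (ai i) (bi i)) + s₂) 1 ^ 2)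
    have h3 : 0 ≤ 8 / 3 * (h + 4 * R₀) := by positivity
    linarith
  -- the end: not low (core avoidance), lateral radius, `≤ 11` contacts
  obtain ⟨hyX, hydeg, hylat, hylow⟩ := walkEnd_not_low_apart hX hsE hcert hσ₁ L₁ s₀ R₀ h ρ hρ2 P₁ hP₁X hcell hP₁ _ hM₂ hapart
    (s := (L₂ (bp (mi i) (ai i) (bi i)) + s₂, [⟨L₂, r, 0⟩])) hI hW hlast hlat' hfuel
  have hylat1 : (walkRun X zt N (L₂ (bp (mi i) (ai i) (bi i)) + s₂, [⟨L₂, r, 0⟩])).1 0 ^ 2 +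
      (walkRun X zt N (L₂ (bp (mi i) (ai i) (bi i)) + s₂, [⟨L₂, r, 0⟩])).1 1 ^ 2 ≤ (ρ - 1) ^ 2 := hylat.trans (by nlinarith)
  -- NOT HIGH by sealing: above `h + R₀ + 2` the end would be a plate site with twelve neighbours
  have hmono := walkRun_height_ge hX hsE hcert hztn N (L₂ (bp (mi i) (ai i) (bi i)) + s₂, [⟨L₂, r, 0⟩]) hI
  simp only at hmono
  rw [hzti, hzti] at hmono
  set y := (walkRun X zt N (L₂ (bp (mi i) (ai i) (bi i)) + s₂, [⟨L₂, r, 0⟩])).1 with hy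
  have hhigh' : y 2 ≤ h + R₀ + 2 := by
    by_contra hlt
    push Not at hlt
    -- `y` is a plate ball
    have hyP : y ∈ P₂ := by
      by_contra hyP
      exact stacking_sealing_above hσ₂ L₂ s₂ (h + R₀) (h + 2 * R₀) ρ hρ X P₂ hX hP₂X hP₂ y hyX hyP (by linarith)
        (hcell y hyX).2.1 hylat1
    obtain ⟨⟨y', hy'S, hyy'⟩, -, -, -⟩ := (hP₂ y).1 hyP
    obtain ⟨m, a, b, rfl⟩ := hy'S
    have hyy : L₂ (barlowPos 1 (Real.sqrt (2 / 3)) σ₂ m a b) + s₂ = y := hyy'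
    -- all its touching sites are occupied
    have hcomp := barlowWindow_complete_gen L₂ s₂ (h + R₀) (h + 2 * R₀) ρ hρ P₂ hP₂X hP₂ m a b (by rw [hyy]; linarith)
      (by rw [hyy]; linarith) (by rw [hyy]; exact hylat1)
    have h12 := twelve_le_card_contacts_of_complete_site hσ₂ L₂ s₂ m a b hcomp
    rw [hyy] at h12
    omega
  have hPAY : y ∈ X.filter (fun y => (X.filter fun q => dist y q = 1).card ≠ 12 ∧ -R₀ - 2 ≤ y 2 ∧ y 2 ≤ h + R₀ + 2) := by
    rw [Finset.mem_filter]
    exact ⟨hyX, by omega, by linarith, hhigh'⟩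
  exact ⟨hI, hW, hlast, ⟨⟨L₂, r, 0⟩, [], rfl, hC⟩, hfuel, hPAY⟩

end CellTop

end Summit.Ventures.Crystal3D.Theorems

end
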